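import Summits.HodgeConjecture.HodgeConjecture.Theorems.F0P2iRIGinfArith          -- ★ RIG∞″ rows A1∕A2: `hasUnitaryArchType_inv_zero_right`, `hasUnitaryArchType_grdProduct`, `hasUnitaryArchType_congr_left`
import Summits.HodgeConjecture.HodgeConjecture.Theorems.F0P2uS2SharpTheta         -- ★ S2♯-θ (p845234): `memXiFamily_of_theta_of_clauses` + FILE 1∕2∕3 (`exists_xi_dictionary`, non-split ∕ split clauses)
import Summits.HodgeConjecture.HodgeConjecture.Theorems.F0P3XiArchDataOfRecord    -- ★ `hasUnitaryArchType_unique`, `archTypeOfRecord`, `hasUnitaryArchType_archTypeOfRecord`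
import Literature.NumberTheory.Automorphic.IdeleClassCharacterHecke               -- ★ `hasUnitaryArchType_toHeckeCharacter_iff`, `isUnitary_toHeckeCharacter`
import Literature.NumberTheory.Automorphic.Liu2021.CheckOfChi                     -- ★ `checkOfChi_infiniteIdeles` (`χ̌_∞ = 1`)
import Literature.NumberTheory.Automorphic.Liu2021.CheckOfChiCompanionCharacter   -- ★ `isUnitary_checkOfChi_cm`
import HarnessLib

/-!
# LH1 (GO 500, half A, h413) — THE ARCHIMEDEAN PIN OF S2♯ ON THE THETA LOCUS: the forward theta dictionary `ξ` of ★ `F0P2uXiOfThetaDatum`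
# is of cohomological type for trivial coefficients at EVERY complex embedding, and S2♯-θ upgrades to S2♯'s full conclusion (hypothesis-free)

Cell `hodgecm-mathlib`, FLOOR 0, crux H413 = `stmt-HodgeConjecture-24833`, route of record `HCCMUnconditional` (no route verbs); line LH1
(SEATPLAN «GO 500» v1 §1B ∕ §5; seat LH1-p03 (g0), DEFAULT organ-side file announced on the LH1 bus 2026-09-02T02:22Z), closer stub
`stub_S2sharp : Literature.NumberTheory.Rogawski1990.cohDiscrete_memXiFamily_archPinned` (`Cruxes/H413/Lines/F0_U3LettersRung1.lean` ED. 38 :64;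
pay-down leaf `Cruxes/H413/Lines/F0_P3c_S2SharpPaydown.lean` 10355e03d0b94504 with organs FIN ∕ PIN-ι ∕ PIN-τ).  THEOREMS ONLY (no `def`, no
instance, no notation, no named fact, no `sorry`); never imports a `Cruxes/…/Lines` module; `--supports stmt-HodgeConjecture-24833 --as helper`.

WHAT THIS FILE PROVES (in-house; no printed statement is claimed).  Write `η̃ = ξ.bcη`, `ψ̃ = ξ.bcψ` (unitary archimedean types `(2eη, 0)`, `(2eψ, 0)`),
`μ̃ = toHeckeCharacter L μ` for an idèle-class character `μ` of WEIGHT ONE (★ `IdeleClassGroup.HasWeight L μ 1`, [Liu2021 Def. 4.3]: ∞-type `e` with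
`|e_w| = 1`), `μω` of unitary type `(k, 0)`, and assume the two GLOBAL DICTIONARY PINS of ★ `F0P2uXiOfThetaDatum.exists_xi_dictionary`
  (hdμ) `μ̃ = η̃⁻¹ · ψ̃⁻¹ · μω`,   (hdχ) `χ̌ = ψ̃⁻¹ · (η̃⁻¹ψ̃⁻¹μω)²`   (`χ̌ = HeckeCharacter.checkOfChi`, trivial at infinity).
* §1 `exponents_of_pins`: reading archimedean types (unique for unitary characters, ★ `hasUnitaryArchType_unique`) gives
  `e_w = k_w − 2eη_w − 2eψ_w` from (hdμ) (★ RIG∞″ row A2 `hasUnitaryArchType_grdProduct`) and `−2eψ_w + 2e_w = 0` from (hdχ), hence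
  `eψ_w = e_w = ±1` and `2eη_w = k_w − 3e_w` — at every place `w`: `(eψ_w = 1 ∧ 2eη_w = k_w − 3) ∨ (eψ_w = −1 ∧ 2eη_w = k_w + 3)`.
* §2 `isCohTrivialAt_of_exponents`: those two cases are EXACTLY the two cohomological cases of ★ `isCohTrivialAt_tOfArchType_iff` at every
  embedding `ι` over `w` (both signs of ★ `expAt`: `(q, 2p − x) = (∓e_w, ±3e_w) ∈ {(1, −3), (−1, 3)}`), and force `k_w` odd; so
  `ξ.IsCohTrivialAt (tOfArchType k ι) ι` for ALL `ι`, i.e. ★ `XiArchPinned L ξ μω k` (`xiArchPinned_of_dictionary`).  This is the CONVERSE of ★ RIG∞″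
  (`F0P2iRIGinfArith`: pin ⇒ `η̃⁻¹ψ̃⁻¹μω` of weight one and `ψ̃⁻¹(η̃⁻¹ψ̃⁻¹μω)²` of type `(0,0)`): on the dictionary, PIN ⟺ WEIGHT ONE.
* §3 `stubS2sharpTheta_archPinned`: ★ S2♯-θ `F0P2uS2SharpTheta.stubS2sharpTheta_holds` (binders VERBATIM, including its hitherto idle `HasWeight L μ 1`)
  with the conclusion UPGRADED from `∃ ξ, MemXiFamily P … ξ` to S2♯'s `∃ ξ, MemXiFamily P … ξ ∧ ∀ k, μω.HasUnitaryArchType k 0 → ∀ ι′,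
  ξ.IsCohTrivialAt (tOfArchType k ι′) ι′` — the letter #80 `cohDiscrete_memXiFamily_archPinned` ON THE THETA LOCUS, hypothesis-free (same `ξ` = the
  forward dictionary; finite half = ★ FILE 4 §1 assembly over ★ FILE 2∕3; archimedean half = §2).
USE.  (i) A sorry-free regression witness for the «WHY IT MIGHT FAIL AS TYPED» risk recorded on the PIN organs of the LH1 leaf (the split-label
convention of ★ `MemXiFamily` vs the sign of ★ `tOfArchType`): on the one locus where `ξ` is explicit, the family's `ξ` IS pinned with the letter's
sign.  (ii) The organ TEXTS PIN-ι ∕ PIN-τ restricted to theta-type `P` follow by U♭ on the cotangent locus (★ `F0P3cMemXiFamilyRigidOfCot`, LH1-p02) —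
left to the sibling file of LH1-p04 if wanted.  (iii) Pays NO print row: #80 S2♯ stays UNPROVED (rung-5 print for non-theta `P`).
HONEST LABEL.  HC_CM is proved only modulo the 7 printed citations (2 remaining: hLiu418 = stmt-HodgeConjecture-24832, h413 = stmt-HodgeConjecture-24833)
until rung 0 closes; this file closes no print letter.

## References
* [Rogawski1990] J. Rogawski, *Automorphic Representations of Unitary Groups in Three Variables*, Ann. of Math. Stud. 123 (1990): §12.2 (2) p. 174
  (`ξ(h) = η′(det₀ h)χ₂(det h)`), §12.3 pp. 174–178 (the parameter `t`, `μ(z) = (z/z̄)^{t+1/2}`; Prop. 12.3.3 p. 178), §13.1 p. 199, Prop. 15.2.1 (b) p. 249.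
* [GelbartRogawski1991] S. Gelbart, J. Rogawski, Invent. Math. 105 (1991): §5.1 (5.1.1) p. 465, Lem. 5.1.2 p. 466 (the theta dictionary).
* [Liu2021] Y. Liu, Camb. J. Math. 9 (2021) = arXiv:2102.11518: Def. 4.3 (weight), Remark 4.2 (unitary archimedean types), App. D §D.1 (l. 5224) (`χ̌`).
* [Patrikis2019] S. Patrikis, *Variations on a theorem of Tate*, Mem. AMS 258 (2019): §2.1 (unitary archimedean types).
-/

set_option autoImplicit false
-- the mandated namespace repeats the single-problem summit's segment (`HodgeConjecture.HodgeConjecture`)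
set_option linter.dupNamespace false

noncomputable section

open scoped Matrix Kronecker MatrixGroups MonoidAlgebra ComplexOrder
open NumberField NumberField.InfinitePlace IsDedekindDomain MeasureTheory
open Literature.NumberTheory Literature.NumberTheory.Automorphic Literature.NumberTheory.Automorphic.UnitaryGroup
open Literature.NumberTheory.Automorphic.UnitaryGroup.CotangentForms
open Literature.NumberTheory.Automorphic.IdeleClassGroup
open Literature.NumberTheory.Automorphic.Liu2021 Literature.NumberTheory.Automorphic.Liu2021.AppendixC
open Literature.NumberTheory.Automorphic.Liu2021.Def411WeilCarriers
open Literature.NumberTheory.Automorphic.Liu2021.Def411WeilCarriersDoubling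
open Literature.NumberTheory.Automorphic.Liu2021.CheckOfChi
open Literature.NumberTheory.GelbartRogawski1991 Literature.NumberTheory.GelbartRogawski1991.UnitaryDualPair
open Literature.NumberTheory.GelbartRogawski1991.UnitaryDualPair.WeilCoinv
open Literature.NumberTheory.GelbartRogawski1991.UnitaryDualPair.LocalSplitting
open Literature.RepresentationTheory Literature.RepresentationTheory.Liu2021
open Literature.NumberTheory.GaloisRepresentations Literature.RepresentationTheory.HarrisKudlaSweet1996
open Literature.NumberTheory.Rogawski1990
open Summit.HodgeConjecture.CorCM
open Summit.HodgeConjecture.HodgeConjecture.Cruxes.H413.F0P2iRIGinfArith (hasUnitaryArchType_inv_zero_right hasUnitaryArchType_grdProduct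
  hasUnitaryArchType_congr_left)
open Summit.HodgeConjecture.HodgeConjecture.Cruxes.H413.F0P3XiArchDataOfRecord (hasUnitaryArchType_unique archTypeOfRecord archTypeOfRecord_eq
  hasUnitaryArchType_archTypeOfRecord)

namespace Summit.HodgeConjecture.HodgeConjecture.Cruxes.H413.F0P3cXiArchPinnedOfThetaDictionary

/-! ## §1 The archimedean exponents of the dictionary `ξ` -/

section Core

variable {L : Type} [Field L] [NumberField L] [IsCMField L]

omit [IsCMField L] in
/-- `χ̌`-shaped characters have unitary archimedean type `(0, 0)`: a Hecke character that is `1` on every infinite idèle `(x_∞, 1)` has type `(0,0)`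
(`archUnitaryValue 0 0 z = 1`). [cite: Patrikis2019, §2.1] -/
theorem hasUnitaryArchType_zero_of_infiniteIdeles_eq_one {ν : HeckeCharacter L} (hν : ∀ x : (InfiniteAdeleRing L)ˣ, ν (infiniteIdeles L x) = 1) :
    ν.HasUnitaryArchType (fun _ => 0) (fun _ => 0) := by
  intro x
  rw [hν x, Units.val_one]
  refine (Finset.prod_eq_one fun w _ => ?_).symm
  simp [archUnitaryValue]

/-- **`χ̌` has unitary archimedean type `(0, 0)`** (★ `checkOfChi_infiniteIdeles`: `χ̌_∞ = 1`). [cite: Liu2021, App. D §D.1 (l. 5224); Def. 4.3] -/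
theorem hasUnitaryArchType_zero_checkOfChi (hcc : IsCMField.complexConj L * IsCMField.complexConj L = 1)
    (χ : Chi (↥(maximalRealSubfield L)) L (IsCMField.complexConj L)) :
    (HeckeCharacter.checkOfChi hcc χ).HasUnitaryArchType (fun _ => 0) (fun _ => 0) :=
  hasUnitaryArchType_zero_of_infiniteIdeles_eq_one (checkOfChi_infiniteIdeles hcc χ)

/-- **§1 THE EXPONENTS OF THE DICTIONARY `ξ`.**  For `ξ = (η, ψ)`, `μω` of unitary type `(k, 0)`, `μ` of weight one, under (hdμ) `μ̃ = η̃⁻¹ψ̃⁻¹μω` and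
the type-`(0,0)` ∕ unitarity of `ν := ψ̃⁻¹(η̃⁻¹ψ̃⁻¹μω)²` (both supplied by (hdχ) `χ̌ = ν`, see `isCohTrivialAt_of_dictionary`): at every infinite place `w`,
`(eψ_w = 1 ∧ 2eη_w = k_w − 3) ∨ (eψ_w = −1 ∧ 2eη_w = k_w + 3)`.  ARITHMETIC: `μ̃` has type `e` with `|e_w| = 1` (★ `hasUnitaryArchType_toHeckeCharacter_iff`);
(hdμ) and ★ RIG∞″ A2 give `η̃⁻¹ψ̃⁻¹μω` the types `e` and `k − 2eη − 2eψ`, equal by ★ uniqueness; `ν` then has type `−2eψ + 2e`, which is `0`.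
[cite: Rogawski1990, §12.3 pp. 174–178; Prop. 15.2.1 (b) p. 249] [cite: Liu2021, Def. 4.3; Remark 4.2] -/
theorem exponents_of_pins (ξ : OneDimAutRepH L) (μω : HeckeCharacter L) (k : InfinitePlace L → ℤ)
    (hk : μω.HasUnitaryArchType k (fun _ => 0))
    (μ : Literature.NumberTheory.Automorphic.IdeleClassGroup L →ₜ* Circle) (hw : HasWeight L μ 1)
    (hdμ : toHeckeCharacter L μ = ξ.bcη⁻¹ * ξ.bcψ⁻¹ * μω)
    (hν : (ξ.bcψ⁻¹ * (ξ.bcη⁻¹ * ξ.bcψ⁻¹ * μω) ^ 2).HasUnitaryArchType (fun _ => 0) (fun _ => 0))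
    (hνu : (ξ.bcψ⁻¹ * (ξ.bcη⁻¹ * ξ.bcψ⁻¹ * μω) ^ 2).IsUnitary) (w : InfinitePlace L) :
    (ξ.eψ w = 1 ∧ 2 * ξ.eη w = k w - 3) ∨ (ξ.eψ w = -1 ∧ 2 * ξ.eη w = k w + 3) := by
  obtain ⟨e, he, hwe⟩ := hw
  -- `|e_w| = 1`
  have h1 : (e w).natAbs = 1 := by
    have h := congrFun hwe w
    simpa [IdeleClassGroup.weight] using h
  -- `μ̃` has type `e`; transported along (hdμ)
  have hX : (ξ.bcη⁻¹ * ξ.bcψ⁻¹ * μω).HasUnitaryArchType e (fun _ => 0) := by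
    rw [← hdμ]
    exact (hasUnitaryArchType_toHeckeCharacter_iff L μ e).2 he
  have hXu : (ξ.bcη⁻¹ * ξ.bcψ⁻¹ * μω).IsUnitary := by
    rw [← hdμ]
    exact isUnitary_toHeckeCharacter L μ
  -- RIG∞″ A2: the same character has type `k − 2eη − 2eψ`
  have hX' := hasUnitaryArchType_grdProduct L ξ μω k hk
  have heq : e = fun w => k w - 2 * ξ.eη w - 2 * ξ.eψ w := hasUnitaryArchType_unique hXu hX hX'
  -- `ν = ψ̃⁻¹ X X` has type `−2eψ + (e + e)`, which must be `0`
  have hψ : ξ.bcψ⁻¹.HasUnitaryArchType (fun w => -(2 * ξ.eψ w)) (fun _ => 0) :=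
    hasUnitaryArchType_inv_zero_right L ξ.bcψ _ ξ.hasUnitaryArchType_bcψ
  have hν' : (ξ.bcψ⁻¹ * (ξ.bcη⁻¹ * ξ.bcψ⁻¹ * μω) ^ 2).HasUnitaryArchType (fun w => -(2 * ξ.eψ w) + (e w + e w)) (fun _ => 0) := by
    rw [pow_two]
    exact hψ.mul_zero_right L (hX.mul_zero_right L hX)
  have h0 : (fun w => -(2 * ξ.eψ w) + (e w + e w)) = fun _ => (0 : ℤ) := hasUnitaryArchType_unique hνu hν' hν
  have hew : e w = k w - 2 * ξ.eη w - 2 * ξ.eψ w := congrFun heq w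
  have h0w : -(2 * ξ.eψ w) + (e w + e w) = 0 := congrFun h0 w
  rcases Int.natAbs_eq_iff.1 h1 with h | h
  · left
    constructor <;> omega
  · right
    constructor <;> omega

/-! ## §2 The pin at every embedding -/

/-- **§2 THE PIN FROM THE EXPONENTS.**  If at every place `w` either `eψ_w = 1 ∧ 2eη_w = k_w − 3` or `eψ_w = −1 ∧ 2eη_w = k_w + 3`, then every `k_w` is odd and
`ξ.IsCohTrivialAt (tOfArchType k ι) ι` at EVERY complex embedding `ι` (both embeddings over `w`: ★ `expAt` flips all three of `p, q, x` together, and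
`(q, 2p − x) ∈ {(1, −3), (−1, 3)}` = ★ `isCohTrivialAt_tOfArchType_iff`). [cite: Rogawski1990, §12.3 p. 178; Prop. 15.2.1 (b) p. 249] -/
theorem isCohTrivialAt_of_exponents (ξ : OneDimAutRepH L) (k : InfinitePlace L → ℤ)
    (hexp : ∀ w : InfinitePlace L, (ξ.eψ w = 1 ∧ 2 * ξ.eη w = k w - 3) ∨ (ξ.eψ w = -1 ∧ 2 * ξ.eη w = k w + 3)) :
    (∀ w : InfinitePlace L, Odd (k w)) ∧ ∀ ι : L →+* ℂ, ξ.IsCohTrivialAt (ArchSignRecipe.tOfArchType k ι) ι := by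
  have hodd : ∀ w : InfinitePlace L, Odd (k w) := fun w => by
    rcases hexp w with ⟨_, h⟩ | ⟨_, h⟩
    · exact ⟨ξ.eη w + 1, by omega⟩
    · exact ⟨ξ.eη w - 2, by omega⟩
  refine ⟨hodd, fun ι => ?_⟩
  rw [isCohTrivialAt_tOfArchType_iff ξ k hodd ι]
  simp only [OneDimAutRepH.qψ, OneDimAutRepH.pη, OneDimAutRepH.expAt]
  rcases hexp (InfinitePlace.mk ι) with ⟨h1, h2⟩ | ⟨h1, h2⟩ <;> split_ifs <;> omega

/-- **THE DICTIONARY `ξ` IS ARCH-PINNED** (pins in, pin out): under (hdμ) and the type-`(0,0)`∕unitarity of `ν` — `XiArchPinned L ξ μω k`.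
[cite: Rogawski1990, Prop. 15.2.1 (b) p. 249; §12.3 pp. 174–178] [cite: Liu2021, Def. 4.3; Remark 4.2] -/
theorem xiArchPinned_of_pins (ξ : OneDimAutRepH L) (μω : HeckeCharacter L) (k : InfinitePlace L → ℤ)
    (hk : μω.HasUnitaryArchType k (fun _ => 0))
    (μ : Literature.NumberTheory.Automorphic.IdeleClassGroup L →ₜ* Circle) (hw : HasWeight L μ 1)
    (hdμ : toHeckeCharacter L μ = ξ.bcη⁻¹ * ξ.bcψ⁻¹ * μω)
    (hν : (ξ.bcψ⁻¹ * (ξ.bcη⁻¹ * ξ.bcψ⁻¹ * μω) ^ 2).HasUnitaryArchType (fun _ => 0) (fun _ => 0))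
    (hνu : (ξ.bcψ⁻¹ * (ξ.bcη⁻¹ * ξ.bcψ⁻¹ * μω) ^ 2).IsUnitary) :
    XiArchPinned L ξ μω k :=
  ⟨hk, isCohTrivialAt_of_exponents ξ k (exponents_of_pins ξ μω k hk μ hw hdμ hν hνu)⟩

/-- **§2′ THE THETA DICTIONARY IS ARCH-PINNED.**  For `μ` of weight one, `χ ∈ Chi`, `μω` of unitary type `(k,0)` and `ξ` under the two dictionary pins
(hdμ) `μ̃ = η̃⁻¹ψ̃⁻¹μω`, (hdχ) `χ̌ = ψ̃⁻¹(η̃⁻¹ψ̃⁻¹μω)²` of ★ `F0P2uXiOfThetaDatum.exists_xi_dictionary`: every `k_w` is odd and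
`ξ.IsCohTrivialAt (tOfArchType k ι) ι` at every `ι` (`χ̌` is unitary of type `(0,0)`: ★ `isUnitary_checkOfChi_cm`, ★ `checkOfChi_infiniteIdeles`).
[cite: Rogawski1990, Prop. 15.2.1 (b) p. 249; §12.3 pp. 174–178] [cite: GelbartRogawski1991, §5.1 (5.1.1) p. 465] [cite: Liu2021, Def. 4.3; App. D §D.1 (l. 5224)] -/
theorem isCohTrivialAt_of_dictionary (ξ : OneDimAutRepH L) (μω : HeckeCharacter L) (k : InfinitePlace L → ℤ)
    (hk : μω.HasUnitaryArchType k (fun _ => 0))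
    (μ : Literature.NumberTheory.Automorphic.IdeleClassGroup L →ₜ* Circle) (hw : HasWeight L μ 1)
    (hcc : IsCMField.complexConj L * IsCMField.complexConj L = 1) (χ : Chi (↥(maximalRealSubfield L)) L (IsCMField.complexConj L))
    (hdμ : toHeckeCharacter L μ = ξ.bcη⁻¹ * ξ.bcψ⁻¹ * μω)
    (hdχ : HeckeCharacter.checkOfChi hcc χ = ξ.bcψ⁻¹ * (ξ.bcη⁻¹ * ξ.bcψ⁻¹ * μω) ^ 2) :
    (∀ w : InfinitePlace L, Odd (k w)) ∧ ∀ ι : L →+* ℂ, ξ.IsCohTrivialAt (ArchSignRecipe.tOfArchType k ι) ι :=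
  isCohTrivialAt_of_exponents ξ k
    (exponents_of_pins ξ μω k hk μ hw hdμ (hdχ ▸ hasUnitaryArchType_zero_checkOfChi hcc χ) (hdχ ▸ isUnitary_checkOfChi_cm hcc χ))

/-- `XiArchPinned L ξ μω k` for the theta dictionary `ξ` (★ F0P2's currency). [cite: Rogawski1990, Prop. 15.2.1 (b) p. 249] [cite: Liu2021, Def. 4.3] -/
theorem xiArchPinned_of_thetaDictionary (ξ : OneDimAutRepH L) (μω : HeckeCharacter L) (k : InfinitePlace L → ℤ)
    (hk : μω.HasUnitaryArchType k (fun _ => 0))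
    (μ : Literature.NumberTheory.Automorphic.IdeleClassGroup L →ₜ* Circle) (hw : HasWeight L μ 1)
    (hcc : IsCMField.complexConj L * IsCMField.complexConj L = 1) (χ : Chi (↥(maximalRealSubfield L)) L (IsCMField.complexConj L))
    (hdμ : toHeckeCharacter L μ = ξ.bcη⁻¹ * ξ.bcψ⁻¹ * μω)
    (hdχ : HeckeCharacter.checkOfChi hcc χ = ξ.bcψ⁻¹ * (ξ.bcη⁻¹ * ξ.bcψ⁻¹ * μω) ^ 2) :
    XiArchPinned L ξ μω k :=
  ⟨hk, isCohTrivialAt_of_dictionary ξ μω k hk μ hw hcc χ hdμ hdχ⟩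

/-- **PIN ⟺ WEIGHT ONE on the dictionary** (this file's §2 with ★ RIG∞″ `F0P2iRIGinfDischarge.hasWeight_one_of_toHeckeCharacter_eq`'s input): under (hdμ),(hdχ)
and `μω` of unitary type `(k,0)`, `XiArchPinned L ξ μω k ↔ HasWeight L μ 1`.  Forward direction by ★ RIG∞″ row A3 (`grdExponent_cases_of_xiArchPinned`):
`μ̃` has type `k − 2eη − 2eψ ∈ {±1}` placewise. [cite: Rogawski1990, Prop. 15.2.1 (b) p. 249; §12.3 p. 178] [cite: Liu2021, Def. 4.3] -/
theorem xiArchPinned_iff_hasWeight_one (ξ : OneDimAutRepH L) (μω : HeckeCharacter L) (k : InfinitePlace L → ℤ)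
    (hk : μω.HasUnitaryArchType k (fun _ => 0))
    (μ : Literature.NumberTheory.Automorphic.IdeleClassGroup L →ₜ* Circle)
    (hcc : IsCMField.complexConj L * IsCMField.complexConj L = 1) (χ : Chi (↥(maximalRealSubfield L)) L (IsCMField.complexConj L))
    (hdμ : toHeckeCharacter L μ = ξ.bcη⁻¹ * ξ.bcψ⁻¹ * μω)
    (hdχ : HeckeCharacter.checkOfChi hcc χ = ξ.bcψ⁻¹ * (ξ.bcη⁻¹ * ξ.bcψ⁻¹ * μω) ^ 2) :
    XiArchPinned L ξ μω k ↔ HasWeight L μ 1 := by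
  refine ⟨fun hpin => ?_, fun hw => xiArchPinned_of_thetaDictionary ξ μω k hk μ hw hcc χ hdμ hdχ⟩
  -- `μ̃ = η̃⁻¹ψ̃⁻¹μω` has type `k − 2eη − 2eψ`, of modulus one at every place under the pin (RIG∞″ A2∕A3)
  have hX := hasUnitaryArchType_grdProduct L ξ μω k hpin.1
  rw [← hdμ] at hX
  have he : HasInfinityType L μ (fun w => k w - 2 * ξ.eη w - 2 * ξ.eψ w) := (hasUnitaryArchType_toHeckeCharacter_iff L μ _).1 hX
  refine ⟨_, he, funext fun w => ?_⟩
  have hc := F0P2iRIGinfArith.grdExponent_cases_of_xiArchPinned L ξ μω k hpin w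
  simp only [IdeleClassGroup.weight, Pi.one_apply]
  rcases hc with ⟨-, h⟩ | ⟨-, h⟩ <;> rw [h] <;> rfl

end Core

/-! ## §3 S2♯ on the theta locus, FULL (finite half ★ S2♯-θ, archimedean half §2) -/

set_option synthInstance.maxHeartbeats 400000 in
set_option maxHeartbeats 8000000 in
/-- **S2♯ ON THE THETA LOCUS, HYPOTHESIS-FREE.**  The binders of ★ `F0P2uS2SharpTheta.stubS2sharpTheta_holds` VERBATIM (Rogawski's frame `(L, ι, H, T, hT)`,
a rational theta frame `(e₁, dV, g, ιV)`, an automorphic measure, a discrete automorphic `P`, Rogawski's unitary `μω` with `μω|_{𝕀_{L⁺}} = ε_{L∕L⁺}`, `μ`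
conjugate symplectic OF WEIGHT ONE, a line `a`, `χ ∈ Chi`, and `P.HasFinComponent (rhoAtLine … ιV a χ)`), with the conclusion of the print letter #80 S2♯
★ `Rogawski1990.cohDiscrete_memXiFamily_archPinned`: `∃ ξ, MemXiFamily P … μω hμu ξ ∧ ∀ k, μω.HasUnitaryArchType k 0 → ∀ ι′, ξ.IsCohTrivialAt (tOfArchType k ι′) ι′`.
`ξ :=` the forward dictionary (★ FILE 1 `exists_xi_dictionary`); the family by ★ FILE 4 §1 `memXiFamily_of_theta_of_clauses` over the non-split clause ★ FILE 2
`nonsplit_clause_of_hasFinComponent_theta`; the pin by §2 `isCohTrivialAt_of_dictionary` — the weight-one binder, idle in ★ S2♯-θ, is what the pin costs.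
[cite: Rogawski1990, §13.1 p. 199; §12.2 (2) p. 174; §12.3 pp. 174–178; Prop. 15.2.1 (b) p. 249; §14.6 p. 246] [cite: GelbartRogawski1991, §5.1 (5.1.1) p. 465, Lem. 5.1.2 p. 466]
[cite: Liu2021, Def. 4.3; Def. 4.11 (l. 2090–2096); App. D §D.1 (l. 5224)] -/
theorem stubS2sharpTheta_archPinned :
  ∀ (L : Type) [Field L] [NumberField L] [IsCMField L] (ι : L →+* ℂ) (H : Matrix (Fin 3) (Fin 3) L) (T : GL (Fin 3) ℂ)
    (hT : (T : Matrix (Fin 3) (Fin 3) ℂ)ᴴ * H.map ι * (T : Matrix (Fin 3) (Fin 3) ℂ) = Literature.Geometry.ComplexHyperbolic.BallModel.J),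
    (∀ τ' : L →+* ℂ, InfinitePlace.mk τ' ≠ InfinitePlace.mk ι → (H.map τ').PosDef) → 2 ≤ Module.finrank ℚ ↥(maximalRealSubfield L) →
    ∀ {n' : ℕ} (e₁ : Fin 3 × Fin 1 ≃ Fin n') (dV : Fin 3 → L) (hdV : ∀ i, IsCMField.complexConj L (dV i) = dV i)
      (hdV0 : ∀ i, dV i ≠ 0) (g : GL (Fin 3) L)
      (hg : ((g : Matrix (Fin 3) (Fin 3) L).map (cmConjRingHom L))ᵀ * H * (g : Matrix (Fin 3) (Fin 3) L) = Matrix.diagonal dV)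
      (ιV : finAdelic (↥(maximalRealSubfield L)) L (IsCMField.complexConj L) 3 H →*
          finAdelic (↥(maximalRealSubfield L)) L (IsCMField.complexConj L) 3 (Matrix.diagonal dV)),
        (∀ k, ((ιV k : finAdelic (↥(maximalRealSubfield L)) L (IsCMField.complexConj L) 3 (Matrix.diagonal dV)) :
            GL (Fin 3) (FiniteAdeleRing (𝓞 L) L)) =
          (toFinAdeleGL L 3 g)⁻¹ * (k : GL (Fin 3) (FiniteAdeleRing (𝓞 L) L)) * toFinAdeleGL L 3 g) →
        ∀ (μA : Measure (adelicGroupData (↥(maximalRealSubfield L)) L (IsCMField.complexConj L) 3 H).automorphicQuotient)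
          [(adelicGroupData (↥(maximalRealSubfield L)) L (IsCMField.complexConj L) 3 H).IsAutomorphicMeasure μA]
          (P : DiscreteAutomorphicRep (adelicGroupData (↥(maximalRealSubfield L)) L (IsCMField.complexConj L) 3 H) μA),
          ∀ (μω : HeckeCharacter L) (hμu : μω.IsUnitary),
            (∀ x : Literature.NumberTheory.GaloisRepresentations.ideleGroup ↥(maximalRealSubfield L),
              μω (AdeleRing.ideleBaseChange (↥(maximalRealSubfield L)) L x) = quadraticHeckeCharCM L x) →
            ∀ (μ : Literature.NumberTheory.Automorphic.IdeleClassGroup L →ₜ* Circle) (hμ : IsConjugateSymplectic L μ), HasWeight L μ 1 →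
              ∀ (a : (↥(maximalRealSubfield L))ˣ) (χ : Chi (↥(maximalRealSubfield L)) L (IsCMField.complexConj L)),
                P.HasFinComponent
                  (rhoAtLine (↥(maximalRealSubfield L)) L (IsCMField.complexConj L) 3 e₁ (Matrix.diagonal dV)
                    (complexConj_imagUnit L) (imagUnit_ne_zero L) (imagUnit_mul_self L) (realDiagonal_isSymm L dV hdV)
                    (isUnit_det_realDiagonal L dV hdV hdV0) (realDiagonal_map L dV hdV).symm
                    (fun a => isCompatible_chiSplittingLine L e₁ dV hdV hdV0 (toHeckeCharacter L μ)
                      (isUnitary_toHeckeCharacter L μ) ((isOscillatorChar_toHeckeCharacter_iff μ).mpr hμ)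
                      (TW (↥(maximalRealSubfield L)) a) (isSymm_TW (↥(maximalRealSubfield L)) a)
                      (isUnit_det_TW (↥(maximalRealSubfield L)) a) (JW (↥(maximalRealSubfield L)) L a)
                      (JW_eq (↥(maximalRealSubfield L)) L a)) ιV a χ) →
                  ∃ ξ : OneDimAutRepH L,
                    MemXiFamily P (transpose_map_cmConjRingHom_eq_of_frame L ι H T hT) (isUnit_det_of_frame L ι H T hT) μω hμu ξ ∧
                      ∀ k : InfinitePlace L → ℤ, μω.HasUnitaryArchType k (fun _ => 0) →
                        ∀ ι' : L →+* ℂ, ξ.IsCohTrivialAt (ArchSignRecipe.tOfArchType k ι') ι' := by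
  intro L _ _ _ ι H T hT _hdef _h2 n' e₁ dV hdV hdV0 g hg ιV hιV μA _ P μω hμu hquad μ hμ hw a χ hfin
  obtain ⟨ξ, hμξ, hχξ⟩ := F0P2uXiOfThetaDatum.exists_xi_dictionary L μω hquad μ hμ (Def411WeilCarriers.complexConj_mul_complexConj' L) χ
  refine ⟨ξ, F0P2uS2SharpTheta.memXiFamily_of_theta_of_clauses L H _ _ e₁ dV hdV hdV0 g hg ιV hιV μA P ξ μω hμu μ hμ a χ _ hμξ hχξ hfin
    (fun v hv => F0P2uMemXiFamilyThetaNonsplit.nonsplit_clause_of_hasFinComponent_theta L H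
      (transpose_map_cmConjRingHom_eq_of_frame L ι H T hT) (isUnit_det_of_frame L ι H T hT) e₁ dV hdV hdV0 g hg ιV hιV μA P
      μω hμu hquad μ hμ a χ hfin ξ _ hμξ hχξ v hv), fun k hk ι' => ?_⟩
  exact (isCohTrivialAt_of_dictionary ξ μω k hk μ hw (Def411WeilCarriers.complexConj_mul_complexConj' L) χ hμξ hχξ).2 ι'

/-- **… read at the type of record `k₀ = archTypeOfRecord μω`** (★ `F0P3XiArchDataOfRecord`): on the theta locus the dictionary `ξ` satisfies
`MemXiFamily P … ξ ∧ ∀ ι′, ξ.IsCohTrivialAt (tOfArchType k₀ ι′) ι′` — the SHORT form of S2♯ (LH1-p02's `s2sharp_iff_short`) on this locus.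
[cite: Rogawski1990, Prop. 15.2.1 (b) p. 249; §12.3 pp. 174–178] [cite: Liu2021, Remark 4.2; Def. 4.3] -/
theorem isCohTrivialAt_archTypeOfRecord_of_thetaDictionary {L : Type} [Field L] [NumberField L] [IsCMField L]
    (ξ : OneDimAutRepH L) (μω : HeckeCharacter L) (hμu : μω.IsUnitary)
    (hquad : ∀ x : Literature.NumberTheory.GaloisRepresentations.ideleGroup ↥(maximalRealSubfield L),
      μω (AdeleRing.ideleBaseChange (↥(maximalRealSubfield L)) L x) = quadraticHeckeCharCM L x)
    (μ : Literature.NumberTheory.Automorphic.IdeleClassGroup L →ₜ* Circle) (hw : HasWeight L μ 1)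
    (hcc : IsCMField.complexConj L * IsCMField.complexConj L = 1) (χ : Chi (↥(maximalRealSubfield L)) L (IsCMField.complexConj L))
    (hdμ : toHeckeCharacter L μ = ξ.bcη⁻¹ * ξ.bcψ⁻¹ * μω)
    (hdχ : HeckeCharacter.checkOfChi hcc χ = ξ.bcψ⁻¹ * (ξ.bcη⁻¹ * ξ.bcψ⁻¹ * μω) ^ 2) (ι : L →+* ℂ) :
    ξ.IsCohTrivialAt (ArchSignRecipe.tOfArchType (archTypeOfRecord μω) ι) ι :=
  (isCohTrivialAt_of_dictionary ξ μω _ (hasUnitaryArchType_archTypeOfRecord μω hμu hquad) μ hw hcc χ hdμ hdχ).2 ι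

end Summit.HodgeConjecture.HodgeConjecture.Cruxes.H413.F0P3cXiArchPinnedOfThetaDictionary

end
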